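/-
Origin: written from primary sources — R. Howe, *θ-series and invariant theory*, Proc. Sympos. Pure Math. 33.1 (1979) §3 (see-saw /
restriction of the Weil representation to a sub-pair differs from the sub-pair's own Weil representation by a character of the
splittings); S. Gelbart, J. Rogawski, Invent. Math. 105 (1991) §3.1 p. 454 (the model `𝒮(𝕎_𝔸)` read in coordinates), Prop. 3.1.1
p. 455, Remark p. 457 L4–13 (two splittings over a unitary dual pair differ by a character; the theta kernel changes by that
character); A. Weil, Acta Math. 111 (1964) Chap. III n° 41 p. 193 (`ω_ψ ∘ s`).  Adapted: no.  This file only COLLAPSES the tree's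
own definitions `cmLineRepRaw_k = seesawConjRep_{k+1}` (`UnitaryDualPairSeesawCMLines` §1, `…SeesawCMLinesConj` §1) onto the
small pair's Weil representation `cmPairRep e₁ hGR_k` (`UnitaryDualPairThetaKernelCM`) times a NAMED character, in both the
`Fin N × Fin 1` and the `Fin n₁` currencies.  Kernel only; no records; nothing cited as a hypothesis.
-/
import Literature.NumberTheory.GelbartRogawski1991.UnitaryDualPairSeesawCMLinesConj
import HarnessLib

-- buildfix G11b-3 recipe (LEDGER B13-1/B13-3): elaborate sequentially so the trailing `attribute [implicit_reducible]`
-- block (reducibilityCoreExt is keyed to the async environment branch) is in force at `.olean` export.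
set_option Elab.async false

/-!
# The CM line representations collapsed onto the small pair's Weil representation (`ω_k″ = χ_k • ω_ψ ∘ s_{V,⟨a_k⟩}`)

Setting of `UnitaryDualPairSeesawCMLines` / `…SeesawCMLinesConj`: CM field `L` (`L⁺ = maximalRealSubfield L`), `V = diag(dV)` of
rank `N`, the plane `W = diag(a₀,a₁)` with compatible splitting `splittingOf hGR`, the lines `⟨a_k⟩` (resp. `⟨b_k⟩` of the conjugated
plane `ᵗḡ₀ · diag(a) · g₀ = diag(b)`) with compatible splittings `splittingOf hGR_k` ([GelbartRogawski1991, Prop. 3.1.1]), models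
`𝒮(𝔸_{L⁺}^{N × 1})` and `𝒮(𝔸_{L⁺}^{n₁})` along `e₁ : Fin N × Fin 1 ≃ Fin n₁` (`R_{e₁} = piSBReindex L⁺ e₁`).

By DEFINITION (`UnitaryDualPairSeesawThetaProduct.seesawConjRep₁/₂`) the raw line representation `ω_k″ = cmLineRepRaw_k` is the
TWIST (`SeesawScalar.twist`) of `ω_ψ^{N×1} ∘ pairSmall (splittingOf hGR_k)` by the see-saw character `(v,z) ↦ λ_V′(v) · λ₃(z)`
(`charV₃₄ · char₃`, line `0`) resp. `(v,z) ↦ λ₄(z)` (`char₄`, line `1`), and `pairSmall s = R_{e₁}⁻¹ ∘ s_pair ∘` (reindexing of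
record, `UnitaryDualPairSeesawSchemeSmall.pairSmall₁/₂`; `ω_T(R_e⁻¹ q) Φ = R_e⁻¹ (ω_{reindex T}(q) (R_e Φ))` is
`Weil1964/AdelicMetaplecticSeesawSum.adelicMpCont.omega_reindex_symm_apply`).  This file names the characters at the CM data and
proves the values (all four raw values are definitional unfoldings after `seesawConjRep₁/₂_apply`):

* §1 (plane `diag(a)`, `g = 1`, `C = 1`) **`cmLineChar₀ = (λ_V′ ∘ pr₁) · (λ₃ ∘ pr₂)`**, **`cmLineChar₁ = λ₄ ∘ pr₂`** on
  `U(V)(𝔸) × U(⟨a_k⟩)(𝔸)`; **`cmLineRepRaw₀/₁_apply`**: `ω_k″(v,z) Φ = χ_k(v,z) • R_{e₁}⁻¹ (cmPairRep e₁ hGR_k (v,z) (R_{e₁} Φ))`;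
  **`cmLineRepFin₀/₁_apply_eq_smul_cmPairRep`**: in the `Fin n₁` currency and for the twisted representations
  `cmLineRepFin_k η_k` on `U(V)(𝔸) × ker N_{L/L⁺}`,
  `cmLineRepFin_k η_k (v,t) φ = (η_k(v,u) · χ_k(v, centre u)) • cmPairRep e₁ hGR_k (v, centre u) φ`, `u = t♭`
  (`cmAdelicOneEquivRelNormOne⁻¹`), `centre = CMCenter` ([Howe1979, §3]; [GelbartRogawski1991, Remark p. 457]);
* §2 the same four values for the conjugated plane (`cmConjLineChar₀/₁`, `cmConjLineRepRaw₀/₁_apply`,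
  `cmConjLineRepFin₀/₁_apply_eq_smul_cmPairRep`).

Provenance / use (Hodge-CM model-construction cell, BINDER-OWNERS row `S`, theta-3's junction (J-a) of 2026-08-19): the arch
`weight` identity `ω(1, t_∞) testFun = w(t) • testFun` for `ω = lineRepOf k = cmLineRepFin_k η_k` (`HodgeCM/Model/ArchSideTerm`)
reduces by these lemmas to the small pair's `cmPairRep e₁ hGR_k` at torus elements (operator level, generic ranks:
`HypCensus/ArchDatumCM`), a scalar character aside.  Nothing here is a claim of the manuscripts under adjudication: kernel
analysis over the tree's constructed objects.
-/

set_option autoImplicit false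

noncomputable section

open scoped Matrix Kronecker
open NumberField
open Literature.RepresentationTheory Literature.RepresentationTheory.SeesawScalar
open Literature.NumberTheory.Automorphic
open Literature.NumberTheory.Automorphic.UnitaryGroup
open Literature.NumberTheory.Weil1964

namespace Literature.NumberTheory.GelbartRogawski1991

namespace UnitaryDualPair

/-! ## §1 The plane `diag(a₀, a₁)` (`g = 1`, `C = 1`) -/

section Plane

variable (L : Type) [Field L] [NumberField L] [IsCMField L] {N n n₁ : ℕ}
  (e : Fin N × Fin 2 ≃ Fin n) (e₁ : Fin N × Fin 1 ≃ Fin n₁)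
variable (dV : Fin N → L) (hdV : ∀ i, IsCMField.complexConj L (dV i) = dV i) (hdV0 : ∀ i, dV i ≠ 0)
variable (a : Fin 2 → L) (ha : ∀ i, IsCMField.complexConj L (a i) = a i) (ha0 : ∀ i, a i ≠ 0)
variable (hGR : (cmSplittingDatum L e dV hdV hdV0 a ha ha0).CompatibleSplitting)
  (hGR₀ : (cmSplittingDatum L e₁ dV hdV hdV0 (lineVec L (a 0)) (fun _ => ha 0) (fun _ => ha0 0)).CompatibleSplitting)
  (hGR₁ : (cmSplittingDatum L e₁ dV hdV hdV0 (lineVec L (a 1)) (fun _ => ha 1) (fun _ => ha0 1)).CompatibleSplitting)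
  (η₀ η₁ : CMAdelic L dV × CMAdelicOne L →* ℂˣ)

/-- **`χ₀ = (λ_V′ ∘ pr₁) · (λ₃ ∘ pr₂)`**: the see-saw character by which `ω₀″ = cmLineRepRaw₀` is twisted
(`charV₃₄`, `char₃` of `UnitaryDualPairSeesawThetaProduct` at the CM data, `g = 1`, `C = 1`). [cite: Howe1979, §3] -/
def cmLineChar₀ : CMAdelic L dV × CMAdelic L (lineVec L (a 0)) →* ℂˣ :=
  (charV₃₄ (↥(maximalRealSubfield L)) L (IsCMField.complexConj L) N 1 1 e e₁ e₁ (Matrix.diagonal dV)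
    (Matrix.diagonal a) (Matrix.diagonal (lineVec L (a 0))) (Matrix.diagonal (lineVec L (a 1)))
    (complexConj_imagUnit L) (imagUnit_ne_zero L) (imagUnit_mul_self L)
    (realDiagonal_isSymm L dV hdV) (realDiagonal_isSymm L a ha)
    (realDiagonal_isSymm L (lineVec L (a 0)) fun _ => ha 0) (realDiagonal_isSymm L (lineVec L (a 1)) fun _ => ha 1)
    (isUnit_det_realDiagonal L dV hdV hdV0) (isUnit_det_realDiagonal L a ha ha0)
    (isUnit_det_realDiagonal L (lineVec L (a 0)) (fun _ => ha 0) fun _ => ha0 0)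
    (isUnit_det_realDiagonal L (lineVec L (a 1)) (fun _ => ha 1) fun _ => ha0 1)
    ((Matrix.isUnit_iff_isUnit_det _).1
      (isUnit_kronecker_map (↥(maximalRealSubfield L)) N (isUnit_det_realDiagonal L dV hdV hdV0)
        (isUnit_det_realDiagonal L a ha ha0)))
    (realDiagonal_map L dV hdV).symm (realDiagonal_map L a ha).symm
    (realDiagonal_map L (lineVec L (a 0)) fun _ => ha 0).symm (realDiagonal_map L (lineVec L (a 1)) fun _ => ha 1).symm
    (coe_one_GL_eq_map L (AdeleRing (𝓞 L) L) (Fin (1 + 1))) (adelicIsometry_one_lineVec L a)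
    (coe_one_GL_eq_map (↥(maximalRealSubfield L)) (AdeleRing (𝓞 ↥(maximalRealSubfield L)) ↥(maximalRealSubfield L))
      (Fin N × Fin (1 + 1)))
    (gramIntertwiner_one_lineVec L a ha (realDiagonal L dV hdV))
    (splittingOf_isCompatible _ _ _ _ _ _ _ _ _ _ _ _ _ _ _ _ _ hGR)
    (splittingOf_isCompatible _ _ _ _ _ _ _ _ _ _ _ _ _ _ _ _ _ hGR₀)
    (splittingOf_isCompatible _ _ _ _ _ _ _ _ _ _ _ _ _ _ _ _ _ hGR₁)).comp (MonoidHom.fst _ _) *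
  (char₃ (↥(maximalRealSubfield L)) L (IsCMField.complexConj L) N 1 1 e e₁ e₁ (Matrix.diagonal dV)
    (Matrix.diagonal a) (Matrix.diagonal (lineVec L (a 0))) (Matrix.diagonal (lineVec L (a 1)))
    (complexConj_imagUnit L) (imagUnit_ne_zero L) (imagUnit_mul_self L)
    (realDiagonal_isSymm L dV hdV) (realDiagonal_isSymm L a ha)
    (realDiagonal_isSymm L (lineVec L (a 0)) fun _ => ha 0) (realDiagonal_isSymm L (lineVec L (a 1)) fun _ => ha 1)
    (isUnit_det_realDiagonal L dV hdV hdV0) (isUnit_det_realDiagonal L a ha ha0)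
    (isUnit_det_realDiagonal L (lineVec L (a 0)) (fun _ => ha 0) fun _ => ha0 0)
    (isUnit_det_realDiagonal L (lineVec L (a 1)) (fun _ => ha 1) fun _ => ha0 1)
    ((Matrix.isUnit_iff_isUnit_det _).1
      (isUnit_kronecker_map (↥(maximalRealSubfield L)) N (isUnit_det_realDiagonal L dV hdV hdV0)
        (isUnit_det_realDiagonal L a ha ha0)))
    (realDiagonal_map L dV hdV).symm (realDiagonal_map L a ha).symm
    (realDiagonal_map L (lineVec L (a 0)) fun _ => ha 0).symm (realDiagonal_map L (lineVec L (a 1)) fun _ => ha 1).symm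
    (coe_one_GL_eq_map L (AdeleRing (𝓞 L) L) (Fin (1 + 1))) (adelicIsometry_one_lineVec L a)
    (coe_one_GL_eq_map (↥(maximalRealSubfield L)) (AdeleRing (𝓞 ↥(maximalRealSubfield L)) ↥(maximalRealSubfield L))
      (Fin N × Fin (1 + 1)))
    (gramIntertwiner_one_lineVec L a ha (realDiagonal L dV hdV))
    (splittingOf_isCompatible _ _ _ _ _ _ _ _ _ _ _ _ _ _ _ _ _ hGR)
    (splittingOf_isCompatible _ _ _ _ _ _ _ _ _ _ _ _ _ _ _ _ _ hGR₀)
    (splittingOf_isCompatible _ _ _ _ _ _ _ _ _ _ _ _ _ _ _ _ _ hGR₁)).comp (MonoidHom.snd _ _)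

/-- **`χ₁ = λ₄ ∘ pr₂`**: the see-saw character by which `ω₁″ = cmLineRepRaw₁` is twisted (`char₄` at the CM data, `g = 1`, `C = 1`).
[cite: Howe1979, §3] -/
def cmLineChar₁ : CMAdelic L dV × CMAdelic L (lineVec L (a 1)) →* ℂˣ :=
  (char₄ (↥(maximalRealSubfield L)) L (IsCMField.complexConj L) N 1 1 e e₁ e₁ (Matrix.diagonal dV)
    (Matrix.diagonal a) (Matrix.diagonal (lineVec L (a 0))) (Matrix.diagonal (lineVec L (a 1)))
    (complexConj_imagUnit L) (imagUnit_ne_zero L) (imagUnit_mul_self L)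
    (realDiagonal_isSymm L dV hdV) (realDiagonal_isSymm L a ha)
    (realDiagonal_isSymm L (lineVec L (a 0)) fun _ => ha 0) (realDiagonal_isSymm L (lineVec L (a 1)) fun _ => ha 1)
    (isUnit_det_realDiagonal L dV hdV hdV0) (isUnit_det_realDiagonal L a ha ha0)
    (isUnit_det_realDiagonal L (lineVec L (a 0)) (fun _ => ha 0) fun _ => ha0 0)
    (isUnit_det_realDiagonal L (lineVec L (a 1)) (fun _ => ha 1) fun _ => ha0 1)
    ((Matrix.isUnit_iff_isUnit_det _).1
      (isUnit_kronecker_map (↥(maximalRealSubfield L)) N (isUnit_det_realDiagonal L dV hdV hdV0)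
        (isUnit_det_realDiagonal L a ha ha0)))
    (realDiagonal_map L dV hdV).symm (realDiagonal_map L a ha).symm
    (realDiagonal_map L (lineVec L (a 0)) fun _ => ha 0).symm (realDiagonal_map L (lineVec L (a 1)) fun _ => ha 1).symm
    (coe_one_GL_eq_map L (AdeleRing (𝓞 L) L) (Fin (1 + 1))) (adelicIsometry_one_lineVec L a)
    (coe_one_GL_eq_map (↥(maximalRealSubfield L)) (AdeleRing (𝓞 ↥(maximalRealSubfield L)) ↥(maximalRealSubfield L))
      (Fin N × Fin (1 + 1)))
    (gramIntertwiner_one_lineVec L a ha (realDiagonal L dV hdV))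
    (splittingOf_isCompatible _ _ _ _ _ _ _ _ _ _ _ _ _ _ _ _ _ hGR)
    (splittingOf_isCompatible _ _ _ _ _ _ _ _ _ _ _ _ _ _ _ _ _ hGR₀)
    (splittingOf_isCompatible _ _ _ _ _ _ _ _ _ _ _ _ _ _ _ _ _ hGR₁)).comp (MonoidHom.snd _ _)

/-- **`ω₀″(v,z) Φ = χ₀(v,z) • R_{e₁}⁻¹ (cmPairRep e₁ hGR₀ (v,z) (R_{e₁} Φ))`**: the raw line representation is the small pair's
Weil representation (read back along `e₁`) twisted by `χ₀`. [cite: Howe1979, §3; GelbartRogawski1991, §3.1 Remark p. 457 L4–13] -/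
theorem cmLineRepRaw₀_apply (v : CMAdelic L dV) (z : CMAdelic L (lineVec L (a 0)))
    (Φ : piSchwartzBruhat (↥(maximalRealSubfield L)) (Fin N × Fin 1)) :
    cmLineRepRaw₀ L e e₁ dV hdV hdV0 a ha ha0 hGR hGR₀ hGR₁ (v, z) Φ =
      ((cmLineChar₀ L e e₁ dV hdV hdV0 a ha ha0 hGR hGR₀ hGR₁ (v, z) : ℂˣ) : ℂ) •
        (piSBReindex (↥(maximalRealSubfield L)) e₁).symm
          (cmPairRep L e₁ dV hdV hdV0 (lineVec L (a 0)) (fun _ => ha 0) (fun _ => ha0 0) hGR₀ (v, z)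
            (piSBReindex (↥(maximalRealSubfield L)) e₁ Φ)) := by
  unfold cmLineRepRaw₀
  rw [seesawConjRep₁_apply]
  congr 1

/-- **`ω₁″(v,z) Φ = χ₁(v,z) • R_{e₁}⁻¹ (cmPairRep e₁ hGR₁ (v,z) (R_{e₁} Φ))`**. [cite: Howe1979, §3; GelbartRogawski1991, §3.1 Remark p. 457 L4–13] -/
theorem cmLineRepRaw₁_apply (v : CMAdelic L dV) (z : CMAdelic L (lineVec L (a 1)))
    (Φ : piSchwartzBruhat (↥(maximalRealSubfield L)) (Fin N × Fin 1)) :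
    cmLineRepRaw₁ L e e₁ dV hdV hdV0 a ha ha0 hGR hGR₀ hGR₁ (v, z) Φ =
      ((cmLineChar₁ L e e₁ dV hdV hdV0 a ha ha0 hGR hGR₀ hGR₁ (v, z) : ℂˣ) : ℂ) •
        (piSBReindex (↥(maximalRealSubfield L)) e₁).symm
          (cmPairRep L e₁ dV hdV hdV0 (lineVec L (a 1)) (fun _ => ha 1) (fun _ => ha0 1) hGR₁ (v, z)
            (piSBReindex (↥(maximalRealSubfield L)) e₁ Φ)) := by
  unfold cmLineRepRaw₁
  rw [seesawConjRep₂_apply]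
  congr 1

/-- **`cmLineRepFin₀ η₀ (v,t) φ = (η₀(v,u) · χ₀(v, centre u)) • cmPairRep e₁ hGR₀ (v, centre u) φ`**, `u = t♭`: in the `Fin n₁`
currency the twisted line representation IS the small pair's Weil representation up to a scalar character.
[cite: Howe1979, §3; GelbartRogawski1991, §3.1 Remark p. 457 L4–13] -/
theorem cmLineRepFin₀_apply_eq_smul_cmPairRep (v : CMAdelic L dV)
    (t : ↥(relNormOneIdeles (↥(maximalRealSubfield L)) L)) (φ : piSchwartzBruhat (↥(maximalRealSubfield L)) (Fin n₁)) :
    cmLineRepFin₀ L e e₁ dV hdV hdV0 a ha ha0 hGR hGR₀ hGR₁ η₀ (v, t) φ =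
      ((η₀ (v, (cmAdelicOneEquivRelNormOne L).symm t) *
            cmLineChar₀ L e e₁ dV hdV hdV0 a ha ha0 hGR hGR₀ hGR₁
              (v, CMCenter L (lineVec L (a 0)) ((cmAdelicOneEquivRelNormOne L).symm t)) : ℂˣ) : ℂ) •
        cmPairRep L e₁ dV hdV hdV0 (lineVec L (a 0)) (fun _ => ha 0) (fun _ => ha0 0) hGR₀
          (v, CMCenter L (lineVec L (a 0)) ((cmAdelicOneEquivRelNormOne L).symm t)) φ := by
  rw [cmLineRepFin₀_apply, cmLineRep₀_apply, cmLineRepRaw₀_apply, LinearEquiv.apply_symm_apply, map_smul, map_smul,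
    LinearEquiv.apply_symm_apply, smul_smul, Units.val_mul]

/-- **`cmLineRepFin₁ η₁ (v,t) φ = (η₁(v,u) · χ₁(v, centre u)) • cmPairRep e₁ hGR₁ (v, centre u) φ`**, `u = t♭`.
[cite: Howe1979, §3; GelbartRogawski1991, §3.1 Remark p. 457 L4–13] -/
theorem cmLineRepFin₁_apply_eq_smul_cmPairRep (v : CMAdelic L dV)
    (t : ↥(relNormOneIdeles (↥(maximalRealSubfield L)) L)) (φ : piSchwartzBruhat (↥(maximalRealSubfield L)) (Fin n₁)) :
    cmLineRepFin₁ L e e₁ dV hdV hdV0 a ha ha0 hGR hGR₀ hGR₁ η₁ (v, t) φ =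
      ((η₁ (v, (cmAdelicOneEquivRelNormOne L).symm t) *
            cmLineChar₁ L e e₁ dV hdV hdV0 a ha ha0 hGR hGR₀ hGR₁
              (v, CMCenter L (lineVec L (a 1)) ((cmAdelicOneEquivRelNormOne L).symm t)) : ℂˣ) : ℂ) •
        cmPairRep L e₁ dV hdV hdV0 (lineVec L (a 1)) (fun _ => ha 1) (fun _ => ha0 1) hGR₁
          (v, CMCenter L (lineVec L (a 1)) ((cmAdelicOneEquivRelNormOne L).symm t)) φ := by
  rw [cmLineRepFin₁_apply, cmLineRep₁_apply, cmLineRepRaw₁_apply, LinearEquiv.apply_symm_apply, map_smul, map_smul,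
    LinearEquiv.apply_symm_apply, smul_smul, Units.val_mul]

end Plane

/-! ## §2 The conjugated plane `ᵗḡ₀ · diag(a) · g₀ = diag(b)` (`g = g₀ ⊗ 1`, `C = 1 ⊗ diag(bᵢ/aᵢ) ⊗ 1`) -/

section ConjPlane

variable (L : Type) [Field L] [NumberField L] [IsCMField L] {N n n₁ : ℕ}
  (e : Fin N × Fin 2 ≃ Fin n) (e₁ : Fin N × Fin 1 ≃ Fin n₁)
variable (dV : Fin N → L) (hdV : ∀ i, IsCMField.complexConj L (dV i) = dV i) (hdV0 : ∀ i, dV i ≠ 0)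
variable (a : Fin 2 → L) (ha : ∀ i, IsCMField.complexConj L (a i) = a i) (ha0 : ∀ i, a i ≠ 0)
variable (b : Fin 2 → L) (hb : ∀ i, IsCMField.complexConj L (b i) = b i) (hb0 : ∀ i, b i ≠ 0) (g₀ : GL (Fin 2) L)
  (hg₀ : ((g₀ : Matrix (Fin 2) (Fin 2) L).map (IsCMField.complexConj L : L →+* L))ᵀ * Matrix.diagonal a *
    (g₀ : Matrix (Fin 2) (Fin 2) L) = Matrix.diagonal b)
variable (hGR : (cmSplittingDatum L e dV hdV hdV0 a ha ha0).CompatibleSplitting)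
  (hGR₀ : (cmSplittingDatum L e₁ dV hdV hdV0 (lineVec L (b 0)) (fun _ => hb 0) (fun _ => hb0 0)).CompatibleSplitting)
  (hGR₁ : (cmSplittingDatum L e₁ dV hdV hdV0 (lineVec L (b 1)) (fun _ => hb 1) (fun _ => hb0 1)).CompatibleSplitting)
  (η₀ η₁ : CMAdelic L dV × CMAdelicOne L →* ℂˣ)

/-- **`χ₀′ = (λ_V′ ∘ pr₁) · (λ₃ ∘ pr₂)`** for the conjugated plane: the see-saw character by which `cmConjLineRepRaw₀` is twisted
(`charV₃₄`, `char₃` at the CM data, `g = g₀ ⊗ 1`, `C = gramConj`). [cite: Howe1979, §3] -/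
def cmConjLineChar₀ : CMAdelic L dV × CMAdelic L (lineVec L (b 0)) →* ℂˣ :=
  (charV₃₄ (↥(maximalRealSubfield L)) L (IsCMField.complexConj L) N 1 1 e e₁ e₁ (Matrix.diagonal dV)
    (Matrix.diagonal a) (Matrix.diagonal (lineVec L (b 0))) (Matrix.diagonal (lineVec L (b 1)))
    (complexConj_imagUnit L) (imagUnit_ne_zero L) (imagUnit_mul_self L)
    (realDiagonal_isSymm L dV hdV) (realDiagonal_isSymm L a ha)
    (realDiagonal_isSymm L (lineVec L (b 0)) fun _ => hb 0) (realDiagonal_isSymm L (lineVec L (b 1)) fun _ => hb 1)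
    (isUnit_det_realDiagonal L dV hdV hdV0) (isUnit_det_realDiagonal L a ha ha0)
    (isUnit_det_realDiagonal L (lineVec L (b 0)) (fun _ => hb 0) fun _ => hb0 0)
    (isUnit_det_realDiagonal L (lineVec L (b 1)) (fun _ => hb 1) fun _ => hb0 1)
    ((Matrix.isUnit_iff_isUnit_det _).1
      (isUnit_kronecker_map (↥(maximalRealSubfield L)) N (isUnit_det_realDiagonal L dV hdV hdV0)
        (isUnit_det_realDiagonal L a ha ha0)))
    (realDiagonal_map L dV hdV).symm (realDiagonal_map L a ha).symm
    (realDiagonal_map L (lineVec L (b 0)) fun _ => hb 0).symm (realDiagonal_map L (lineVec L (b 1)) fun _ => hb 1).symm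
    (val_toAdeleGL L g₀) (adelicIsometry_conj L a b g₀ hg₀)
    (coe_gramConj L a ha ha0 b hb hb0)
    (gramIntertwiner_conj L a ha ha0 b hb hb0 (realDiagonal L dV hdV))
    (splittingOf_isCompatible _ _ _ _ _ _ _ _ _ _ _ _ _ _ _ _ _ hGR)
    (splittingOf_isCompatible _ _ _ _ _ _ _ _ _ _ _ _ _ _ _ _ _ hGR₀)
    (splittingOf_isCompatible _ _ _ _ _ _ _ _ _ _ _ _ _ _ _ _ _ hGR₁)).comp (MonoidHom.fst _ _) *
  (char₃ (↥(maximalRealSubfield L)) L (IsCMField.complexConj L) N 1 1 e e₁ e₁ (Matrix.diagonal dV)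
    (Matrix.diagonal a) (Matrix.diagonal (lineVec L (b 0))) (Matrix.diagonal (lineVec L (b 1)))
    (complexConj_imagUnit L) (imagUnit_ne_zero L) (imagUnit_mul_self L)
    (realDiagonal_isSymm L dV hdV) (realDiagonal_isSymm L a ha)
    (realDiagonal_isSymm L (lineVec L (b 0)) fun _ => hb 0) (realDiagonal_isSymm L (lineVec L (b 1)) fun _ => hb 1)
    (isUnit_det_realDiagonal L dV hdV hdV0) (isUnit_det_realDiagonal L a ha ha0)
    (isUnit_det_realDiagonal L (lineVec L (b 0)) (fun _ => hb 0) fun _ => hb0 0)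
    (isUnit_det_realDiagonal L (lineVec L (b 1)) (fun _ => hb 1) fun _ => hb0 1)
    ((Matrix.isUnit_iff_isUnit_det _).1
      (isUnit_kronecker_map (↥(maximalRealSubfield L)) N (isUnit_det_realDiagonal L dV hdV hdV0)
        (isUnit_det_realDiagonal L a ha ha0)))
    (realDiagonal_map L dV hdV).symm (realDiagonal_map L a ha).symm
    (realDiagonal_map L (lineVec L (b 0)) fun _ => hb 0).symm (realDiagonal_map L (lineVec L (b 1)) fun _ => hb 1).symm
    (val_toAdeleGL L g₀) (adelicIsometry_conj L a b g₀ hg₀)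
    (coe_gramConj L a ha ha0 b hb hb0)
    (gramIntertwiner_conj L a ha ha0 b hb hb0 (realDiagonal L dV hdV))
    (splittingOf_isCompatible _ _ _ _ _ _ _ _ _ _ _ _ _ _ _ _ _ hGR)
    (splittingOf_isCompatible _ _ _ _ _ _ _ _ _ _ _ _ _ _ _ _ _ hGR₀)
    (splittingOf_isCompatible _ _ _ _ _ _ _ _ _ _ _ _ _ _ _ _ _ hGR₁)).comp (MonoidHom.snd _ _)

/-- **`χ₁′ = λ₄ ∘ pr₂`** for the conjugated plane (`char₄` at the CM data, `g = g₀ ⊗ 1`, `C = gramConj`). [cite: Howe1979, §3] -/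
def cmConjLineChar₁ : CMAdelic L dV × CMAdelic L (lineVec L (b 1)) →* ℂˣ :=
  (char₄ (↥(maximalRealSubfield L)) L (IsCMField.complexConj L) N 1 1 e e₁ e₁ (Matrix.diagonal dV)
    (Matrix.diagonal a) (Matrix.diagonal (lineVec L (b 0))) (Matrix.diagonal (lineVec L (b 1)))
    (complexConj_imagUnit L) (imagUnit_ne_zero L) (imagUnit_mul_self L)
    (realDiagonal_isSymm L dV hdV) (realDiagonal_isSymm L a ha)
    (realDiagonal_isSymm L (lineVec L (b 0)) fun _ => hb 0) (realDiagonal_isSymm L (lineVec L (b 1)) fun _ => hb 1)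
    (isUnit_det_realDiagonal L dV hdV hdV0) (isUnit_det_realDiagonal L a ha ha0)
    (isUnit_det_realDiagonal L (lineVec L (b 0)) (fun _ => hb 0) fun _ => hb0 0)
    (isUnit_det_realDiagonal L (lineVec L (b 1)) (fun _ => hb 1) fun _ => hb0 1)
    ((Matrix.isUnit_iff_isUnit_det _).1
      (isUnit_kronecker_map (↥(maximalRealSubfield L)) N (isUnit_det_realDiagonal L dV hdV hdV0)
        (isUnit_det_realDiagonal L a ha ha0)))
    (realDiagonal_map L dV hdV).symm (realDiagonal_map L a ha).symm
    (realDiagonal_map L (lineVec L (b 0)) fun _ => hb 0).symm (realDiagonal_map L (lineVec L (b 1)) fun _ => hb 1).symm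
    (val_toAdeleGL L g₀) (adelicIsometry_conj L a b g₀ hg₀)
    (coe_gramConj L a ha ha0 b hb hb0)
    (gramIntertwiner_conj L a ha ha0 b hb hb0 (realDiagonal L dV hdV))
    (splittingOf_isCompatible _ _ _ _ _ _ _ _ _ _ _ _ _ _ _ _ _ hGR)
    (splittingOf_isCompatible _ _ _ _ _ _ _ _ _ _ _ _ _ _ _ _ _ hGR₀)
    (splittingOf_isCompatible _ _ _ _ _ _ _ _ _ _ _ _ _ _ _ _ _ hGR₁)).comp (MonoidHom.snd _ _)

/-- **`cmConjLineRepRaw₀ (v,z) Φ = χ₀′(v,z) • R_{e₁}⁻¹ (cmPairRep e₁ hGR₀ (v,z) (R_{e₁} Φ))`**.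
[cite: Howe1979, §3; GelbartRogawski1991, §3.1 Remark p. 457 L4–13] -/
theorem cmConjLineRepRaw₀_apply (v : CMAdelic L dV) (z : CMAdelic L (lineVec L (b 0)))
    (Φ : piSchwartzBruhat (↥(maximalRealSubfield L)) (Fin N × Fin 1)) :
    cmConjLineRepRaw₀ L e e₁ dV hdV hdV0 a ha ha0 b hb hb0 g₀ hg₀ hGR hGR₀ hGR₁ (v, z) Φ =
      ((cmConjLineChar₀ L e e₁ dV hdV hdV0 a ha ha0 b hb hb0 g₀ hg₀ hGR hGR₀ hGR₁ (v, z) : ℂˣ) : ℂ) •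
        (piSBReindex (↥(maximalRealSubfield L)) e₁).symm
          (cmPairRep L e₁ dV hdV hdV0 (lineVec L (b 0)) (fun _ => hb 0) (fun _ => hb0 0) hGR₀ (v, z)
            (piSBReindex (↥(maximalRealSubfield L)) e₁ Φ)) := by
  unfold cmConjLineRepRaw₀
  rw [seesawConjRep₁_apply]
  congr 1

/-- **`cmConjLineRepRaw₁ (v,z) Φ = χ₁′(v,z) • R_{e₁}⁻¹ (cmPairRep e₁ hGR₁ (v,z) (R_{e₁} Φ))`**.
[cite: Howe1979, §3; GelbartRogawski1991, §3.1 Remark p. 457 L4–13] -/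
theorem cmConjLineRepRaw₁_apply (v : CMAdelic L dV) (z : CMAdelic L (lineVec L (b 1)))
    (Φ : piSchwartzBruhat (↥(maximalRealSubfield L)) (Fin N × Fin 1)) :
    cmConjLineRepRaw₁ L e e₁ dV hdV hdV0 a ha ha0 b hb hb0 g₀ hg₀ hGR hGR₀ hGR₁ (v, z) Φ =
      ((cmConjLineChar₁ L e e₁ dV hdV hdV0 a ha ha0 b hb hb0 g₀ hg₀ hGR hGR₀ hGR₁ (v, z) : ℂˣ) : ℂ) •
        (piSBReindex (↥(maximalRealSubfield L)) e₁).symm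
          (cmPairRep L e₁ dV hdV hdV0 (lineVec L (b 1)) (fun _ => hb 1) (fun _ => hb0 1) hGR₁ (v, z)
            (piSBReindex (↥(maximalRealSubfield L)) e₁ Φ)) := by
  unfold cmConjLineRepRaw₁
  rw [seesawConjRep₂_apply]
  congr 1

/-- **`cmConjLineRepFin₀ η₀ (v,t) φ = (η₀(v,u) · χ₀′(v, centre u)) • cmPairRep e₁ hGR₀ (v, centre u) φ`**, `u = t♭`.
[cite: Howe1979, §3; GelbartRogawski1991, §3.1 Remark p. 457 L4–13] -/
theorem cmConjLineRepFin₀_apply_eq_smul_cmPairRep (v : CMAdelic L dV)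
    (t : ↥(relNormOneIdeles (↥(maximalRealSubfield L)) L)) (φ : piSchwartzBruhat (↥(maximalRealSubfield L)) (Fin n₁)) :
    cmConjLineRepFin₀ L e e₁ dV hdV hdV0 a ha ha0 b hb hb0 g₀ hg₀ hGR hGR₀ hGR₁ η₀ (v, t) φ =
      ((η₀ (v, (cmAdelicOneEquivRelNormOne L).symm t) *
            cmConjLineChar₀ L e e₁ dV hdV hdV0 a ha ha0 b hb hb0 g₀ hg₀ hGR hGR₀ hGR₁
              (v, CMCenter L (lineVec L (b 0)) ((cmAdelicOneEquivRelNormOne L).symm t)) : ℂˣ) : ℂ) •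
        cmPairRep L e₁ dV hdV hdV0 (lineVec L (b 0)) (fun _ => hb 0) (fun _ => hb0 0) hGR₀
          (v, CMCenter L (lineVec L (b 0)) ((cmAdelicOneEquivRelNormOne L).symm t)) φ := by
  rw [cmConjLineRepFin₀_apply, cmConjLineRep₀_apply, cmConjLineRepRaw₀_apply, LinearEquiv.apply_symm_apply, map_smul,
    map_smul, LinearEquiv.apply_symm_apply, smul_smul, Units.val_mul]

/-- **`cmConjLineRepFin₁ η₁ (v,t) φ = (η₁(v,u) · χ₁′(v, centre u)) • cmPairRep e₁ hGR₁ (v, centre u) φ`**, `u = t♭`.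
[cite: Howe1979, §3; GelbartRogawski1991, §3.1 Remark p. 457 L4–13] -/
theorem cmConjLineRepFin₁_apply_eq_smul_cmPairRep (v : CMAdelic L dV)
    (t : ↥(relNormOneIdeles (↥(maximalRealSubfield L)) L)) (φ : piSchwartzBruhat (↥(maximalRealSubfield L)) (Fin n₁)) :
    cmConjLineRepFin₁ L e e₁ dV hdV hdV0 a ha ha0 b hb hb0 g₀ hg₀ hGR hGR₀ hGR₁ η₁ (v, t) φ =
      ((η₁ (v, (cmAdelicOneEquivRelNormOne L).symm t) *
            cmConjLineChar₁ L e e₁ dV hdV hdV0 a ha ha0 b hb hb0 g₀ hg₀ hGR hGR₀ hGR₁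
              (v, CMCenter L (lineVec L (b 1)) ((cmAdelicOneEquivRelNormOne L).symm t)) : ℂˣ) : ℂ) •
        cmPairRep L e₁ dV hdV hdV0 (lineVec L (b 1)) (fun _ => hb 1) (fun _ => hb0 1) hGR₁
          (v, CMCenter L (lineVec L (b 1)) ((cmAdelicOneEquivRelNormOne L).symm t)) φ := by
  rw [cmConjLineRepFin₁_apply, cmConjLineRep₁_apply, cmConjLineRepRaw₁_apply, LinearEquiv.apply_symm_apply, map_smul,
    map_smul, LinearEquiv.apply_symm_apply, smul_smul, Units.val_mul]

end ConjPlane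

/-! ### Build-lane note (ops-buildfix G11b-3 recipe, LEDGER B13-1, 2026-08-21)
`lean -o` (the hub build lane, never `lean`/the gate check) runs Lean 4.32's library-suggestion indexers
(`Lean.LibrarySuggestions.SymbolFrequency` / `SineQuaNon`, from their `exportEntriesFn`) over the statement of
every local theorem that is not a denied premise; on this family's statements (very large dependent binder
telescopes through the theta-kernel / dual-pair data) that fold runs for tens of minutes to hours and the build
lane kills the job (incident G11b-3, run/shared/lean/ops/buildfix/G11b-3-DOSSIER.md). `isDeniedPremise` skips
`[implicit_reducible]` constants before any fold, and a reducibility status on a *theorem* is inert (Meta never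
unfolds `thmInfo`; the kernel ignores the attribute), so the public theorems of this file are tagged
`[implicit_reducible]` purely to keep them out of that index. Only other effect: they are not offered by
`+suggestions` premise selectors. No statement or proof is changed; superseded if the operator lands a
deny-list form (`HarnessLib.PremiseIndex`). -/
set_option allowUnsafeReducibility true in
attribute [implicit_reducible]
  cmLineRepRaw₀_apply cmLineRepRaw₁_apply cmLineRepFin₀_apply_eq_smul_cmPairRep
  cmLineRepFin₁_apply_eq_smul_cmPairRep cmConjLineRepRaw₀_apply cmConjLineRepRaw₁_apply
  cmConjLineRepFin₀_apply_eq_smul_cmPairRep cmConjLineRepFin₁_apply_eq_smul_cmPairRep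

end UnitaryDualPair

end Literature.NumberTheory.GelbartRogawski1991
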